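import Summits.CriticalPhenomena.PercolationContinuityZ3.Theorems.Transplant.FKConnectivityAllQPat3Levels
import HarnessLib

/-!
# Connectivity correlation inequalities for `φ_{w,q}`, every `q > 0` — THEOREM SP: the conclusion predicate `SPGood` (DEFINITION)

Definitions file (`--supports stmt-CriticalPhenomena-4575`), census lineage (gen 37) of LANE 2's FK sub-programme; builds on
p205010 (kernel theorem, internal audit signed; external expert review pending).  No named facts, no sorries, nothing probabilistic.

`FK.SPGood E b s t` packages the conclusion of THEOREM SP (census g34, PROOF-THEOREM-SP §1.3) for ONE placement `(b, s, t)` of three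
marks on the finite edge set `E`: at every level `μ`, `T_sym(b,s,t) ≥ 0` and `STAR ≥ 0` for each of the three apexes — in the
ordered-table vocabulary of `…Pat3TwoLevelDefs.lean` / `…Pat3Levels.lean`: `0 ≤ lev2 E b s t T μ` for
`T ∈ {tsym2Tab, starXTab (apex b), mirror2 starXTab (apex s), starSTab (apex t)}`.
This file also records the finite table identities that make `SPGood` invariant under permuting the marks
(`FK.SPGood.swap12`, `FK.SPGood.swap23`, `FK.SPGood.rotate`, …) and the scaling helper `FK.SPGood.of_mul` (the certificate theorems
conclude `0 ≤ D · lev2 …`).  Used by `…Pat3SPSteps.lean` / `…Pat3SPRecursion.lean` / `…Pat3TheoremSP.lean` (THEOREM SP on every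
two-terminal series–parallel network, every placement, by structural recursion — census g37).
[cite: AyyerLinussonRavichandran2025, §7 (p. 22)] [cite: Grimmett2006, §3.8 (pp. 61–62)]
-/

namespace Summit.CriticalPhenomena.PercolationContinuityZ3.Theorems

namespace FK

open SimpleGraph Literature.Probability.LatticeModels Literature.Probability.Percolation

/-! ### Table identities (finite, by case analysis) -/

section Tables

/-- `mirror2` is an involution. [folklore] -/
theorem mirror2_mirror2 (F : ℕ → Pat3 → Pat3 → ℤ) : mirror2 (mirror2 F) = F := by
  funext c P Q
  cases P <;> cases Q <;> rfl

/-- `mirror23` is an involution. [folklore] -/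
theorem mirror23_mirror23 (F : ℕ → Pat3 → Pat3 → ℤ) : mirror23 (mirror23 F) = F := by
  funext c P Q
  cases P <;> cases Q <;> rfl

/-- `T_sym` (doubled two-level table) is symmetric under `x ↔ y`. [folklore] -/
theorem mirror2_tsym2Tab : mirror2 tsym2Tab = tsym2Tab := by
  funext c P Q
  rcases c with _ | c <;> cases P <;> cases Q <;> rfl

/-- `T_sym` is symmetric under `y ↔ s`. [folklore] -/
theorem mirror23_tsym2Tab : mirror23 tsym2Tab = tsym2Tab := by
  funext c P Q
  rcases c with _ | c <;> cases P <;> cases Q <;> rfl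

/-- `STAR(s; x, y)` is symmetric under `x ↔ y`. [folklore] -/
theorem mirror2_starSTab : mirror2 starSTab = starSTab := by
  funext c P Q
  rcases c with _ | _ | c <;> cases P <;> cases Q <;> rfl

/-- `STAR(x; y, s)` is symmetric under `y ↔ s`. [folklore] -/
theorem mirror23_starXTab : mirror23 starXTab = starXTab := by
  funext c P Q
  rcases c with _ | _ | c <;> cases P <;> cases Q <;> rfl

/-- `STAR(y; x, s)` with `y ↔ s` exchanged is `STAR(s; x, y)`. [folklore] -/
theorem mirror23_mirror2_starXTab : mirror23 (mirror2 starXTab) = starSTab := by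
  funext c P Q
  rcases c with _ | _ | c <;> cases P <;> cases Q <;> rfl

/-- `STAR(s; x, y)` with `y ↔ s` exchanged is `STAR(y; x, s)`. [folklore] -/
theorem mirror23_starSTab : mirror23 starSTab = mirror2 starXTab := by
  funext c P Q
  rcases c with _ | _ | c <;> cases P <;> cases Q <;> rfl

end Tables

/-! ### The conclusion predicate of THEOREM SP -/

section SPGood

open scoped Classical

variable {V : Type*}

/-- **THEOREM SP's conclusion for one placement** (census g34, PROOF-THEOREM-SP §1.3): on the three-mark network `(E; b, s, t)`,
at every level `μ`, `T_sym(b, s, t) ≥ 0` and `STAR(b; s, t)`, `STAR(s; b, t)`, `STAR(t; b, s) ≥ 0` — as levelwise values of the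
doubled ordered tables `tsym2Tab`, `starXTab`, `mirror2 starXTab`, `starSTab`. [cite: AyyerLinussonRavichandran2025, §7 (p. 22)] -/
def SPGood (E : Finset (Sym2 V)) (b s t : V) : Prop :=
  ∀ μ : ℕ, 0 ≤ lev2 E b s t tsym2Tab μ ∧ 0 ≤ lev2 E b s t starXTab μ ∧
    0 ≤ lev2 E b s t (mirror2 starXTab) μ ∧ 0 ≤ lev2 E b s t starSTab μ

/-- Exchanging the first two marks. [folklore] -/
theorem SPGood.swap12 {E : Finset (Sym2 V)} {b s t : V} (h : SPGood E b s t) : SPGood E s b t := by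
  intro μ
  obtain ⟨h1, h2, h3, h4⟩ := h μ
  refine ⟨?_, ?_, ?_, ?_⟩
  · rw [lev2_swap_xy, mirror2_tsym2Tab]; exact h1
  · rw [lev2_swap_xy]; exact h3
  · rw [lev2_swap_xy, mirror2_mirror2]; exact h2
  · rw [lev2_swap_xy, mirror2_starSTab]; exact h4

/-- Exchanging the last two marks. [folklore] -/
theorem SPGood.swap23 {E : Finset (Sym2 V)} {b s t : V} (h : SPGood E b s t) : SPGood E b t s := by
  intro μ
  obtain ⟨h1, h2, h3, h4⟩ := h μ
  refine ⟨?_, ?_, ?_, ?_⟩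
  · rw [lev2_swap_ys, mirror23_tsym2Tab]; exact h1
  · rw [lev2_swap_ys, mirror23_starXTab]; exact h2
  · rw [lev2_swap_ys, mirror23_mirror2_starXTab]; exact h4
  · rw [lev2_swap_ys, mirror23_starSTab]; exact h3

/-- Cyclic rotation of the marks `(b, s, t) ↦ (s, t, b)`. [folklore] -/
theorem SPGood.rotate {E : Finset (Sym2 V)} {b s t : V} (h : SPGood E b s t) : SPGood E s t b :=
  h.swap12.swap23

/-- Cyclic rotation of the marks `(b, s, t) ↦ (t, b, s)`. [folklore] -/
theorem SPGood.rotate' {E : Finset (Sym2 V)} {b s t : V} (h : SPGood E b s t) : SPGood E t b s :=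
  h.rotate.rotate

/-- Exchanging the first and the last mark. [folklore] -/
theorem SPGood.swap13 {E : Finset (Sym2 V)} {b s t : V} (h : SPGood E b s t) : SPGood E t s b :=
  h.rotate.swap12

/-- `SPGood` is invariant under rewriting the edge set. [folklore] -/
theorem SPGood.congr_edges {E E' : Finset (Sym2 V)} {b s t : V} (h : SPGood E b s t) (hE : E = E') : SPGood E' b s t :=
  hE ▸ h

/-- From scaled levelwise certificates `0 ≤ D · lev2` (one positive factor per table) to `SPGood`. [folklore] -/
theorem SPGood.of_mul {E : Finset (Sym2 V)} {b s t : V} {D₁ D₂ D₃ D₄ : ℕ} (hD₁ : 0 < D₁) (hD₂ : 0 < D₂) (hD₃ : 0 < D₃)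
    (hD₄ : 0 < D₄) (h₁ : ∀ μ, 0 ≤ ((D₁ : ℕ) : ℤ) * lev2 E b s t tsym2Tab μ)
    (h₂ : ∀ μ, 0 ≤ ((D₂ : ℕ) : ℤ) * lev2 E b s t starXTab μ)
    (h₃ : ∀ μ, 0 ≤ ((D₃ : ℕ) : ℤ) * lev2 E b s t (mirror2 starXTab) μ)
    (h₄ : ∀ μ, 0 ≤ ((D₄ : ℕ) : ℤ) * lev2 E b s t starSTab μ) : SPGood E b s t := by
  intro μ
  refine ⟨?_, ?_, ?_, ?_⟩
  · exact nonneg_of_mul_nonneg_right (by simpa [mul_comm] using h₁ μ) (by exact_mod_cast hD₁)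
  · exact nonneg_of_mul_nonneg_right (by simpa [mul_comm] using h₂ μ) (by exact_mod_cast hD₂)
  · exact nonneg_of_mul_nonneg_right (by simpa [mul_comm] using h₃ μ) (by exact_mod_cast hD₃)
  · exact nonneg_of_mul_nonneg_right (by simpa [mul_comm] using h₄ μ) (by exact_mod_cast hD₄)

/-- From the weight form (all four members nonnegative for every nonnegative level weight) to `SPGood`. [folklore] -/
theorem SPGood.of_mval2 {E : Finset (Sym2 V)} {b s t : V}
    (h₁ : ∀ w : ℕ → ℝ, (∀ n, 0 ≤ w n) → 0 ≤ mval2 w E b s t tsym2Tab)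
    (h₂ : ∀ w : ℕ → ℝ, (∀ n, 0 ≤ w n) → 0 ≤ mval2 w E b s t starXTab)
    (h₃ : ∀ w : ℕ → ℝ, (∀ n, 0 ≤ w n) → 0 ≤ mval2 w E b s t (mirror2 starXTab))
    (h₄ : ∀ w : ℕ → ℝ, (∀ n, 0 ≤ w n) → 0 ≤ mval2 w E b s t starSTab) : SPGood E b s t :=
  fun μ => ⟨lev2_nonneg_of_mval2 h₁ μ, lev2_nonneg_of_mval2 h₂ μ, lev2_nonneg_of_mval2 h₃ μ, lev2_nonneg_of_mval2 h₄ μ⟩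

/-- `SPGood` gives each member for every nonnegative level weight. [folklore] -/
theorem SPGood.mval2_nonneg {E : Finset (Sym2 V)} {b s t : V} (h : SPGood E b s t) {w : ℕ → ℝ} (hw : ∀ n, 0 ≤ w n) :
    0 ≤ mval2 w E b s t tsym2Tab ∧ 0 ≤ mval2 w E b s t starXTab ∧
      0 ≤ mval2 w E b s t (mirror2 starXTab) ∧ 0 ≤ mval2 w E b s t starSTab :=
  ⟨mval2_nonneg_of_lev2 (fun μ => (h μ).1) hw, mval2_nonneg_of_lev2 (fun μ => (h μ).2.1) hw,
    mval2_nonneg_of_lev2 (fun μ => (h μ).2.2.1) hw, mval2_nonneg_of_lev2 (fun μ => (h μ).2.2.2) hw⟩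

end SPGood

end FK

end Summit.CriticalPhenomena.PercolationContinuityZ3.Theorems
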